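import Mathlib
import Literature.Computability.Complexity.Classes
import Literature.Computability.Complexity.Nondeterministic
import Literature.Computability.Complexity.UniformCircuitClasses
import Literature.Computability.Complexity.RelativizedTime
import Literature.Computability.MetaComplexity.MCSP

/-!
# Chen–Jin–Santhanam–Williams (FOCS 2021), Theorem 1.7: uniform-`AC⁰` REFUTERS for `MCSP[s]`
# magnify to `P ≠ NP` (items 1 and 3; magnification-gap census row R38)

Topic `Literature/Computability/MetaComplexity`, directory `ChenJinSanthanamWilliams2022/`
(bib key `ChenEtAl2022`: L. Chen, C. Jin, R. Santhanam, R. Williams, *Constructive separations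
and their consequences*, FOCS 2021 (IEEE 2022) pp. 646–657 = arXiv:2203.14379 = TheoretiCS 3
(2024)). Companion of the flat files `ConstructiveSeparations*.lean` (Def. 1.1 `IsPRefuter`,
Thm. 1.2, Thm. 1.9), which do NOT cover §4 / Thm. 1.7. Locators below are chunk:line of the held
LaTeX-source text `paper:arxiv-2203.14379` (`pNNNN.txt` = 3000-character chunk `NNNN`).

## The printed statements (verbatim)

* Thm. 1.7 (p0006 L29–39): "Let `s(n) ≥ n^{log(n)^{ω(1)}}` be any time-constructive
  super-quasipolynomial function. In the following, we consider `MCSP[s(n)]` and Parity problems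
  of input length `N = 2^n`. The following hold:
  * (Major Separation from Constructive Lower Bound) If there exists a polylogtime-uniform
    `AC⁰[quasipoly]` refuter for `MCSP[s(n)]` against every polylogtime-uniform `AC⁰` algorithm,
    then `P ≠ NP`. […]
  * (Somewhat Constructive Lower Bound) For `s(n) ≤ o(2^n/n)`, there is a polylogtime-uniform-
    `AC⁰[2^{poly(s(n))}]` refuter for `MCSP[s(n)]` against every polylogtime-uniform `AC⁰`
    algorithm. […] Note that in item 3, the input size `N` to the problem is `N = 2^n`, hence
    `2^{poly(s(n))}` is only slightly super-quasipolynomial in `N`."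
* The refuter notion (p0006 L26): "a polylogtime-uniform-`AC⁰[f(n)]`-refuter for `MCSP[s(n)]`
  against an algorithm `A` is defined as a polylogtime-uniform-`AC⁰` circuit of size `f(n)` that
  outputs a string `x ∈ {0,1}^N` given input `1^N` (where `N = 2^n`), such that for infinitely
  many `N = 2^n`, `A(x) ≠ MCSP[s(n)](x)`."  Uniformity (§4, p0015 L4): "a circuit of size `S` is
  said to be polylogtime-uniform, if there is a `polylog(S)`-time algorithm that decides the type
  of a gate `g` given its `O(log S)`-bit index, and decides whether there is a wire from gate `g₁`
  to gate `g₂` given their indices."  `MCSP[s(n)]` (p0006 L25): "the computational problem that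
  asks whether a Boolean function on `n` bits, represented by its truth table, has circuits of
  size at most `s(n)`" — the tree's `MCSPSize s` (`B₂` gates).
* §4, Proposition "Item (1) of Theorem 1.7" — the CONSTANT-ONE form (p0015 L22–34): "The
  following theorem implies Item (1) of [Thm. 1.7], since the constant `1` function can be
  trivially implemented by a polylogtime-uniform `AC⁰` algorithm. […] Let
  `f(N) ≥ 2^{log log(N)^{ω(1)}}` be a function computable in `poly(f(N))` time. If there exists a
  polylogtime-uniform-`AC⁰[quasipoly]` refuter for `MCSP[f(N)]` against the constant `1` function,
  then `P ≠ NP`."  (Proof, p0015 L32–34: under `P = NP` "the refuter `R` always outputs a string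
  `x` of circuit complexity `2^{log log(N)^{O(1)}}`. But such a string is a YES instance of
  `MCSP[f(N)]`"; the engine is Lemma "(lem:pnpac0)", p0009 L59–72: "Assuming `P = NP`, then for
  every polylogtime-uniform `AC⁰` algorithm `R` such that `R(1^n)` outputs `n` bits, it holds that
  `R(1^n)` has circuit size complexity at most `polylog(n)`" — its proof computes "the `i`-th
  output bit of the circuit `Rₙ` on the input `1ⁿ`, given `n` and `i` in binary" in `PH`.)
* §4, Proposition "Item (3) of Theorem 1.7" (p0016 L6–10): "Let `f(N) ≥ log(N)^{ω(1)}` be a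
  function computable in `poly(f(N))` time, such that `f(N) ≤ o(N/log(N))`. There is a
  polylogtime-uniform-`AC⁰[2^{poly(f(N))}]` refuter for `MCSP[f(N)]` against every
  polylogtime-uniform `AC⁰` algorithm."  (Here `f(N) = s(n)`, `N = 2ⁿ`, p0015 L20–21.)

## How the notions are typed (rendering notes; the census referee audits these)

(i) PRINTED STRING = TRUTH TABLE.  A refuter has no real input (`1^N`) and `N = 2ⁿ` output bits.
We type it as a SINGLE-OUTPUT circuit family `C : CircuitFamily`, `C n : Circuit (Fin n)` reading
an ADDRESS `i ∈ {0,1}ⁿ`, whose truth table `printed C n := truthTable (C n).eval ∈ {0,1}^{2ⁿ}` is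
the printed string.  Multi-output → address form costs an output selector (`+O(N·n)` gates, `+2`
depth); address form → multi-output costs `N` hard-wired copies (`×N` size); and ANY function of
the `n` address bits has a depth-2 circuit of size `n·2ⁿ + 1`.  Both printed size regimes —
`quasipoly(N) = 2^{n^{O(1)}}` (typed `quasipolyBound c n = 2^(n^c + c)`, a cofinal family) and
`2^{poly(s(n))}` (typed `expPolyBound s c n = 2^(s n ^ c + c)`, `s n ≥ n`) — dominate `n·2ⁿ` and
are closed under these conversions, and under `S ↦ 2^{(log S)^{O(1)}}`; consequently, in either
regime, "a uniform `AC⁰[S]` refuter prints `x`" says exactly that the bit `xᵢ` is computable from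
`(n, i)` by an `O(1)`-alternation machine in time `polylog S` (the content of the printed proof
of Lemma (lem:pnpac0)), under every standard uniformity convention (gate-type/adjacency queries as
printed, or the tree's Vollmer-style `k`-th-predecessor direct connection language).
(ii) UNIFORMITY.  The tree's `CircuitFamily.IsDCUniform 𝒰` with `𝒰 = Classes.P` — the direct
connection language, tuples in BINARY of length `Θ(log n + log S)`, decidable in time polynomial
in that length, i.e. `polylog(S)` — is the tree's declared reading of polylogtime-uniformity
(`UniformCircuitClasses.lean`, header: "`𝒰 = Classes.P` is polylogtime-uniformity (Koiran–Perifel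
2009, Rem. 1)"); refuters are typed with it (`IsUniformAC0Family`).
(iii) THE REFUTED ALGORITHM is presented by the LANGUAGE it decides, as in `IsPRefuter`
(`ConstructiveSeparations.lean`): "`A(x) ≠ MCSP[s(n)](x)`" reads `x ∈ MCSP[s] ↔ x ∉ A`.  The
constant `1` function is `A = Set.univ`.
(iv) SAFE DIRECTIONS.  Item 1 is a HYPOTHESIS-side statement: it is typed (a) in the printed
constant-one form `thm17_item1_one` (no algorithm class at all: a quasipoly uniform family
printing, infinitely often, a truth table OUTSIDE `MCSP[s]`), and (b) in the Thm-1.7 form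
`thm17_item1` over `PolylogUniformAC0` = `P`-DCL-uniform constant-depth polynomial-size `acBasis`
families (every printed polylogtime-uniform `AC⁰` algorithm is such a family after the standard
padding that makes `k`-th-predecessor queries answerable by one adjacency query — size `S²`,
depth `+O(1)` — so the typed hypothesis quantifies over AT LEAST the printed algorithms: typed ⇒
printed).  Item 3 is a CONCLUSION-side (known) statement: it is typed over the tree's
DLOGTIME-uniform `UniformAC0` (`𝒰 = DTIME id`), which is contained in the printed adversary class
(Barrington–Immerman–Straubing 1990 §8 / Vollmer 1999 Thm. 4.73: `U_D`-`AC⁰ = FO = LH`, robust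
under the choice of connection language), with the refuter in the address form of (i): printed ⇒
typed.  The two typed adversary classes meet at `A = Set.univ` (constant one), where the census
row R38 compares refuter SIZE: `2^{poly(s(n))}` known (item 3) versus `quasipoly(N) = 2^{n^{O(1)}}`
wanted (item 1) — see `MagnificationGapCensus/UniformAC0Refuters.lean`.
(v) GROWTH CONDITIONS (hypotheses on `s`, typed at least as strong as printed).
"`s(n) ≥ n^{log(n)^{ω(1)}}`" / "`f(N) ≥ 2^{log log(N)^{ω(1)}}`": `IsSuperQuasipoly s :=
∀ c, ∀ᶠ n, 2 ^ (Nat.log 2 n + 1) ^ c ≤ s n` (as `Nat.log 2 n + 1 ≥ log₂ n`, this gives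
`s(n) ≥ 2^{(log₂ n)^c}` for every `c` eventually, i.e. the printed condition; conversely the
printed condition gives it since `(log₂ n + 1)^c ≤ (log₂ n)^{c+1}` eventually).
"`f(N) ≥ log(N)^{ω(1)}`": `IsSuperpoly s := ∀ c, ∀ᶠ n, n ^ c ≤ s n`.  "`s(n) ≤ o(2^n/n)`":
`(fun n => (s n : ℝ)) =o[atTop] (fun n => 2 ^ n / n)`.  "time-constructive" / "computable in
`poly(f(N))` time [given `N` in binary]": the tree's `IsTimeConstructible s` (binary `s n` from
`1ⁿ` in `O(s n)` steps, and `n ≤ s n`), which implies both printed forms.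
(vi) NOT TYPED: item 2 (`PH ⊄ SIZE(s(n)²)` ⇒ the quasipoly refuters exist) and item 4 (quasipoly
LIST-refuters for Parity) — census text only; the remark after the constant-one Proposition
(p0015 L36: the conclusion survives for quasipoly-size uniform `AC⁰` LIST-refuters).
-/

namespace Literature.Computability.MetaComplexity.ChenJinSanthanamWilliams2022

open _root_.Computability Filter Asymptotics
open Literature.Computability.Complexity Literature.Computability.MetaComplexity

/-! ### D9 — uniform `AC⁰` refuters for `MCSP[s]`, in printed-string (truth-table) form -/

/-- **A polylogtime-uniform `AC⁰` circuit family of size `≤ S`** (rendering notes (i)–(ii)): for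
every `n`, `C n` is over `acBasis` (`¬`, unbounded fan-in `∧ₖ`, `∨ₖ`), of `acDepth` at most a
constant `d`, with at most `S n` gates; and the family is `P`-DCL-uniform (`IsDCUniform
Classes.P`: its direct connection language, in binary, is decidable in polynomial time in the
tuple length `Θ(log n + log S n)`, i.e. in time `polylog`).  In the refuter reading, `C n` reads
an address `i ∈ {0,1}ⁿ` and the family PRINTS the `2ⁿ`-bit string `printed C n`.
[cite: ChenEtAl2022, §1.2.2 (refuter for MCSP, p.6) and §4 (polylogtime-uniform, p.15)] -/
def IsUniformAC0Family (S : ℕ → ℕ) (C : CircuitFamily) : Prop :=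
  (∃ d : ℕ, ∀ n, (C n).IsOver acBasis ∧ (C n).acDepth ≤ d ∧ (C n).size ≤ S n) ∧
    C.IsDCUniform Classes.P

/-- **The printed string** of the family at `n`: the truth table of `C n`, a string of length
`N = 2ⁿ` ("outputs a string `x ∈ {0,1}^N` given input `1^N` (where `N = 2^n`)", p0006 L26;
rendering note (i)). [cite: ChenEtAl2022, §1.2.2 (p.6, refuter for MCSP)] -/
def printed (C : CircuitFamily) (n : ℕ) : List Bool :=
  truthTable (C n).eval

/-- The printed string has length `2ⁿ`. [folklore] -/
@[simp] theorem length_printed (C : CircuitFamily) (n : ℕ) : (printed C n).length = 2 ^ n :=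
  length_truthTable _

/-- **Refuter condition, language form** (rendering note (iii)): `C` refutes the algorithm
deciding `A` on `MCSP[s]` — "for infinitely many `N = 2^n`, `A(x) ≠ MCSP[s(n)](x)`" for the
printed string `x = printed C n`, i.e. `x ∈ MCSP[s] ↔ x ∉ A` infinitely often.
[cite: ChenEtAl2022, §1.2.2 (p.6, refuter for MCSP against an algorithm A)] -/
def IsMCSPRefuterAgainst (s : ℕ → ℕ) (A : Language Bool) (C : CircuitFamily) : Prop :=
  ∃ᶠ n in atTop, (printed C n ∈ MCSPSize s ↔ printed C n ∉ A)

/-- **There is a uniform `AC⁰[S]` refuter for `MCSP[s]` against (the algorithm deciding) `A`.**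
[cite: ChenEtAl2022, §1.2.2 (p.6) and Thm. 1.7] -/
def HasRefuter (S : ℕ → ℕ) (s : ℕ → ℕ) (A : Language Bool) : Prop :=
  ∃ C : CircuitFamily, IsUniformAC0Family S C ∧ IsMCSPRefuterAgainst s A C

/-- **`AC⁰[quasipoly]` at input length `N = 2ⁿ`**: size `2^{n^c + c}` — a cofinal family in
`2^{(log N)^{O(1)}}` (rendering note (i)). [cite: ChenEtAl2022, Thm. 1.7 item 1 (AC⁰[quasipoly])] -/
def quasipolyBound (c : ℕ) (n : ℕ) : ℕ := 2 ^ (n ^ c + c)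

/-- **`AC⁰[2^{poly(s(n))}]`**: size `2^{s(n)^c + c}` (rendering note (i)).
[cite: ChenEtAl2022, Thm. 1.7 item 3 (AC⁰[2^{poly(s(n))}])] -/
def expPolyBound (s : ℕ → ℕ) (c : ℕ) (n : ℕ) : ℕ := 2 ^ (s n ^ c + c)

/-- A polylogtime-uniform `AC⁰[quasipoly]` refuter for `MCSP[s]` against `A` exists (Thm. 1.7
item 1's refuters). [cite: ChenEtAl2022, Thm. 1.7 item 1] -/
def HasQuasipolyRefuter (s : ℕ → ℕ) (A : Language Bool) : Prop :=
  ∃ c : ℕ, HasRefuter (quasipolyBound c) s A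

/-- A polylogtime-uniform `AC⁰[2^{poly(s(n))}]` refuter for `MCSP[s]` against `A` exists
(Thm. 1.7 item 3's refuters). [cite: ChenEtAl2022, Thm. 1.7 item 3] -/
def HasExpPolyRefuter (s : ℕ → ℕ) (A : Language Bool) : Prop :=
  ∃ c : ℕ, HasRefuter (expPolyBound s c) s A

/-- **Polylogtime-uniform `AC⁰` (decision) algorithms, by their languages** (rendering notes
(ii)–(iv)): languages decided by a `P`-DCL-uniform `acBasis` family of constant depth and
polynomial size — `UniformDepthSizeClass Classes.P acBasis d p`. Used on the HYPOTHESIS side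
(Thm. 1.7 item 1), where it must contain every printed polylogtime-uniform `AC⁰` algorithm.
[cite: ChenEtAl2022, §4 (p.15, polylogtime-uniform circuits)] -/
noncomputable def PolylogUniformAC0 : Set (Language Bool) :=
  {L | ∃ d : ℕ, ∃ p : Polynomial ℕ,
    L ∈ UniformDepthSizeClass Classes.P acBasis (fun _ => d) (fun n => p.eval n)}

/-! ### Growth conditions on the size parameter `s` (rendering note (v)) -/

/-- **Super-quasipolynomial** `s(n) ≥ n^{log(n)^{ω(1)}}` (equivalently `f(N) ≥ 2^{log log(N)^{ω(1)}}`
at `N = 2ⁿ`): for every `c`, eventually `2^{(⌊log₂ n⌋ + 1)^c} ≤ s n`.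
[cite: ChenEtAl2022, Thm. 1.7 (hypothesis on s)] -/
def IsSuperQuasipoly (s : ℕ → ℕ) : Prop :=
  ∀ c : ℕ, ∀ᶠ n in atTop, 2 ^ (Nat.log 2 n + 1) ^ c ≤ s n

/-- **Super-polynomial** `s(n) ≥ n^{ω(1)}` (printed `f(N) ≥ log(N)^{ω(1)}`): for every `c`,
eventually `n ^ c ≤ s n`. [cite: ChenEtAl2022, §4 Prop. (Item (3) of Thm. 1.7), hypothesis] -/
def IsSuperpoly (s : ℕ → ℕ) : Prop :=
  ∀ c : ℕ, ∀ᶠ n in atTop, n ^ c ≤ s n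

/-! ### The named facts -/

/-- **[CJSW21, §4, Proposition "Item (1) of Theorem 1.7" — constant-one form] (T side of census
row R38).**  For every super-quasipolynomial time-constructible `s`: if some polylogtime-uniform
`AC⁰[quasipoly]` family prints, for infinitely many `n`, a `2ⁿ`-bit string OUTSIDE `MCSP[s]`
(= a refuter against the constant `1` function, `A = Set.univ`), then `P ≠ NP`.  Printed
(p0015 L24–30): "Let `f(N) ≥ 2^{log log(N)^{ω(1)}}` be a function computable in `poly(f(N))`
time. If there exists a polylogtime-uniform-`AC⁰[quasipoly]` refuter for `MCSP[f(N)]` against the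
constant `1` function, then `P ≠ NP`."  Typed hypotheses ⇒ printed ones: rendering notes (i),
(ii), (v). [cite: ChenEtAl2022, §4 Prop. (Item (1) of Thm. 1.7), p.15] -/
def thm17_item1_one : Prop :=
  ∀ s : ℕ → ℕ, IsSuperQuasipoly s → IsTimeConstructible s →
    HasQuasipolyRefuter s Set.univ → Classes.P ≠ Nondeterministic.NP

/-- **[CJSW21, Thm. 1.7 item 1 (Major Separation from Constructive Lower Bound)]** as printed:
for every super-quasipolynomial time-constructible `s`, if against EVERY polylogtime-uniform `AC⁰`
algorithm (typed: every `A ∈ PolylogUniformAC0`, rendering note (iv)) there is a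
polylogtime-uniform `AC⁰[quasipoly]` refuter for `MCSP[s(n)]`, then `P ≠ NP`.  Printed (p0006
L33): "If there exists a polylogtime-uniform `AC⁰[quasipoly]` refuter for `MCSP[s(n)]` against
every polylogtime-uniform `AC⁰` algorithm, then `P ≠ NP`." [cite: ChenEtAl2022, Thm. 1.7 item 1] -/
def thm17_item1 : Prop :=
  ∀ s : ℕ → ℕ, IsSuperQuasipoly s → IsTimeConstructible s →
    (∀ A ∈ PolylogUniformAC0, HasQuasipolyRefuter s A) → Classes.P ≠ Nondeterministic.NP

/-- **[CJSW21, Thm. 1.7 item 3 / §4 Proposition "Item (3) of Theorem 1.7" (Somewhat Constructive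
Lower Bound)] (K side of census row R38).**  For every super-polynomial time-constructible `s`
with `s(n) = o(2ⁿ/n)`, against every DLOGTIME-uniform `AC⁰` algorithm (typed: `A ∈ UniformAC0`,
a subclass of the printed adversaries — rendering note (iv)) there IS a polylogtime-uniform
`AC⁰[2^{poly(s(n))}]` refuter for `MCSP[s(n)]`.  Printed (p0016 L6–10): "Let
`f(N) ≥ log(N)^{ω(1)}` be a function computable in `poly(f(N))` time, such that
`f(N) ≤ o(N/log(N))`. There is a polylogtime-uniform-`AC⁰[2^{poly(f(N))}]` refuter for `MCSP[f(N)]`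
against every polylogtime-uniform `AC⁰` algorithm."  (Proof, p0016 L13–23: Nisan's PRG against
`AC⁰`; the refuter prints the first PRG output rejected by `A`, else the first output of a
`2^{poly(f(N))}`-seed generator outside the — `AC⁰[2^{poly(f(N))}]`-enumerable — YES set of
`MCSP[f(N)]` accepted by `A`.) [cite: ChenEtAl2022, Thm. 1.7 item 3 and §4 Prop. (Item (3)), p.16] -/
def thm17_item3 : Prop :=
  ∀ s : ℕ → ℕ, IsSuperpoly s → IsTimeConstructible s →
    ((fun n => (s n : ℝ)) =o[atTop] fun n => (2 : ℝ) ^ n / n) →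
      ∀ A ∈ UniformAC0, HasExpPolyRefuter s A

/-! ### Proved API: unfolding, sanity, monotonicity, and the links used by the census -/

/-- Against the constant `1` function (`A = Set.univ`) a refuter is exactly a family printing,
infinitely often, a truth table OUTSIDE `MCSP[s]` (as in the printed proof, p0015 L32–34).
[cite: ChenEtAl2022, §4 Prop. (Item (1) of Thm. 1.7), proof] -/
theorem isMCSPRefuterAgainst_univ_iff {s : ℕ → ℕ} {C : CircuitFamily} :
    IsMCSPRefuterAgainst s Set.univ C ↔ ∃ᶠ n in atTop, printed C n ∉ MCSPSize s :=
  ⟨fun h => h.mono fun _ hn hM => (hn.1 hM) (Set.mem_univ _),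
    fun h => h.mono fun _ hn => ⟨fun hM => absurd hM hn, fun h' => (h' (Set.mem_univ _)).elim⟩⟩

/-- Sanity (the notion is not vacuous in the trivial direction): nothing refutes the algorithm
that decides `MCSP[s]` itself. [folklore] -/
theorem not_isMCSPRefuterAgainst_self (s : ℕ → ℕ) (C : CircuitFamily) :
    ¬ IsMCSPRefuterAgainst s (MCSPSize s) C := by
  intro h
  obtain ⟨n, hn⟩ := h.exists
  exact iff_not_self hn

/-- Uniform `AC⁰` families are monotone in the size bound. [folklore] -/
theorem IsUniformAC0Family.mono {S S' : ℕ → ℕ} {C : CircuitFamily} (hS : ∀ n, S n ≤ S' n)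
    (h : IsUniformAC0Family S C) : IsUniformAC0Family S' C := by
  obtain ⟨⟨d, hd⟩, hU⟩ := h
  exact ⟨⟨d, fun n => ⟨(hd n).1, (hd n).2.1, (hd n).2.2.trans (hS n)⟩⟩, hU⟩

/-- Existence of refuters is monotone in the size bound. [folklore] -/
theorem HasRefuter.mono {S S' s : ℕ → ℕ} {A : Language Bool} (hS : ∀ n, S n ≤ S' n)
    (h : HasRefuter S s A) : HasRefuter S' s A := by
  obtain ⟨C, hC, hR⟩ := h
  exact ⟨C, hC.mono hS, hR⟩

/-- `quasipoly(N) ≤ 2^{poly(s(n))}` pointwise once `n ≤ s n`: `2^{n^c+c} ≤ 2^{s(n)^c+c}`.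
[folklore] -/
theorem quasipolyBound_le_expPolyBound {s : ℕ → ℕ} (hs : ∀ n, n ≤ s n) (c n : ℕ) :
    quasipolyBound c n ≤ expPolyBound s c n := by
  unfold quasipolyBound expPolyBound
  exact Nat.pow_le_pow_right (by norm_num) (Nat.add_le_add_right (Nat.pow_le_pow_left (hs n) c) c)

/-- **WANTED ⇒ KNOWN-shape** (the census ordering for R38): for time-constructible `s` (so
`n ≤ s n`), an `AC⁰[quasipoly]` refuter IS an `AC⁰[2^{poly(s(n))}]` refuter.  The converse —
shrinking `2^{poly(s(n))}` to `2^{n^{O(1)}}` — is the open gap. [folklore] -/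
theorem hasExpPolyRefuter_of_hasQuasipolyRefuter {s : ℕ → ℕ} (hs : IsTimeConstructible s)
    {A : Language Bool} (h : HasQuasipolyRefuter s A) : HasExpPolyRefuter s A := by
  obtain ⟨c, hc⟩ := h
  exact ⟨c, hc.mono (quasipolyBound_le_expPolyBound hs.1 c)⟩

/-- **DLOGTIME-uniform `AC⁰` ⊆ polylogtime-uniform `AC⁰`** (uniformity is monotone in the
uniformity class: `DTIME(n) ⊆ P`, `DTIME_id_subset_P` of `RelativizedTime.lean`).
[cite: BarringtonImmermanStraubing1990, §3] -/
theorem UniformAC0_subset_PolylogUniformAC0 : UniformAC0 ⊆ PolylogUniformAC0 := by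
  rintro L ⟨d, p, hL⟩
  exact ⟨d, p, UniformDepthSizeClass_mono DTIME_id_subset_P subset_rfl (fun _ => le_rfl)
    (fun _ => le_rfl) hL⟩

/-- **Thm. 1.7 item 1 from its constant-one form**, given that the constant `1` function is a
polylogtime-uniform `AC⁰` algorithm ("can be trivially implemented", p0015 L22 — here an explicit
hypothesis `Set.univ ∈ PolylogUniformAC0`, since the tree has no constructed uniform family yet).
[cite: ChenEtAl2022, §4 (p.15 L22, "The following theorem implies Item (1)")] -/
theorem thm17_item1_of_one (hU : Set.univ ∈ PolylogUniformAC0) (h : thm17_item1_one) :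
    thm17_item1 :=
  fun s hq ht hA => h s hq ht (hA _ hU)

/-- **K at the constant-one adversary**: item 3 yields, for every admissible `s`, an
`AC⁰[2^{poly(s(n))}]` family printing truth tables OUTSIDE `MCSP[s]` infinitely often — given
that the constant `1` function is a DLOGTIME-uniform `AC⁰` algorithm (`Set.univ ∈ UniformAC0`,
explicit hypothesis as above). This is the KNOWN cell the census compares with `thm17_item1_one`.
[cite: ChenEtAl2022, Thm. 1.7 item 3] -/
theorem hasExpPolyRefuter_univ_of_item3 (h3 : thm17_item3) (hU : Set.univ ∈ UniformAC0)
    {s : ℕ → ℕ} (hp : IsSuperpoly s) (ht : IsTimeConstructible s)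
    (ho : (fun n => (s n : ℝ)) =o[atTop] fun n => (2 : ℝ) ^ n / n) :
    HasExpPolyRefuter s Set.univ :=
  h3 s hp ht ho _ hU

/-- Super-quasipolynomial functions are super-polynomial. [folklore] -/
theorem IsSuperQuasipoly.isSuperpoly {s : ℕ → ℕ} (h : IsSuperQuasipoly s) : IsSuperpoly s := by
  intro c
  filter_upwards [h c, eventually_ge_atTop 2] with n hn hn2
  refine le_trans ?_ hn
  set m := Nat.log 2 n + 1 with hm
  have hm2 : 2 ≤ m := by
    have := Nat.log_pos (b := 2) (n := n) (by norm_num) hn2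
    omega
  have hlt : n < 2 ^ m := Nat.lt_pow_succ_log_self (by norm_num) n
  rcases Nat.eq_zero_or_pos c with rfl | hc
  · norm_num
  · have hcm : c ≤ m ^ (c - 1) := by
      have h1 : c - 1 < 2 ^ (c - 1) := Nat.lt_two_pow_self
      calc c ≤ 2 ^ (c - 1) := by omega
        _ ≤ m ^ (c - 1) := Nat.pow_le_pow_left hm2 _
    calc n ^ c ≤ (2 ^ m) ^ c := Nat.pow_le_pow_left hlt.le c
      _ = 2 ^ (m * c) := by rw [← pow_mul]
      _ ≤ 2 ^ m ^ c := by
          refine Nat.pow_le_pow_right (by norm_num) ?_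
          calc m * c ≤ m * m ^ (c - 1) := Nat.mul_le_mul_left _ hcm
            _ = m ^ c := by
                rw [← pow_succ']
                congr 1
                omega

/-- **The scales are genuinely separated**: for super-quasipolynomial `s`, every quasipoly bound
is eventually STRICTLY below every `2^{poly(s(n))}` bound with exponent `c' ≥ 1` — the numeric
content of the R38 gap (`2^{n^{O(1)}}` wanted versus `2^{s(n)^{O(1)}}` known). [folklore] -/
theorem eventually_quasipolyBound_lt_expPolyBound {s : ℕ → ℕ} (h : IsSuperQuasipoly s)
    (c c' : ℕ) (hc' : 1 ≤ c') :
    ∀ᶠ n in atTop, quasipolyBound c n < expPolyBound s c' n := by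
  -- eventually `n ^ c + c < s n` (super-polynomiality with exponent `c + 1`, and `n ≥ c + 1`)
  have h1 : ∀ᶠ n in atTop, n ^ (c + 1) ≤ s n := h.isSuperpoly (c + 1)
  have h2 : ∀ᶠ n : ℕ in atTop, c + 2 ≤ n := eventually_ge_atTop (c + 2)
  filter_upwards [h1, h2] with n hn hn2
  unfold quasipolyBound expPolyBound
  refine Nat.pow_lt_pow_right (by norm_num) ?_
  have hlt : n ^ c + c < n ^ (c + 1) := by
    have hn1 : 1 ≤ n ^ c := Nat.one_le_pow _ _ (by omega)
    calc n ^ c + c < n ^ c + n ^ c * (c + 1) := by nlinarith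
      _ ≤ n ^ c * n := by nlinarith
      _ = n ^ (c + 1) := by rw [pow_succ]
  have hpos : 0 < s n := lt_of_lt_of_le (Nat.pow_pos (by omega)) hn
  have hs1 : s n ≤ s n ^ c' := by
    calc s n = s n ^ 1 := (pow_one _).symm
      _ ≤ s n ^ c' := Nat.pow_le_pow_right hpos hc'
  calc n ^ c + c < n ^ (c + 1) := hlt
    _ ≤ s n := hn
    _ ≤ s n ^ c' := hs1
    _ ≤ s n ^ c' + c' := Nat.le_add_right _ _

end Literature.Computability.MetaComplexity.ChenJinSanthanamWilliams2022
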